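import Mathlib
import Summits.Ventures.FusionMHD.Models.RwmFRS1
import Summits.Ventures.FusionMHD.Models.KinkEqScrewPinchQ07
import HarnessLib

/-!
# F3.r4 instance «RwmFRS1Kq07»: the external `(2,1)` kink / RESISTIVE WALL MODE of the exact force-balanced
# `q₀ = 7/10` screw pinch (MODEL M_kink of row #95, by name) — MODEL, Newcomb's `f`, `g` in closed form, the marginal
# equation in certificate form, and the boundary form of `δW` (Freidberg (11.148))

LADDER-GRIDFUSION rung F3 (resistive / extended-MHD margins), row F3.r4 of `models/F3-SCOPING.md` (§2 R5 «cylindrical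
RWM, diffuse profile, no rotation: sign of `γ` and the rate `γτ_w = −δW_∞/δW_b`»; writer gridfusion-model-6, g7).  The
`m = 2` companion of rows #71 / «#71′ EQ» (`RwmFRS1*`, external `(3,1)` of the `q₀ = 7/5` member): here the safety factor at
the plasma edge is BELOW TWO (`q_a = 7/5`), the textbook external-kink configuration of a current-carrying cylinder.

MODEL M_RWM,K (MODELLED column; every hypothesis explicit): BY NAME the exact force-balanced equilibrium `KinkEqQ07.hlK` of
row #95 «F3.σ-KINK-UNSTABLE» (sos-6 / lit-4, `Models/KinkEqScrewPinchQ07`): straight circular cylinder of periodicity length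
`2πR₀`, `μ₀ = 1`, `B_z ≡ 1`, `B_θ(r) = 2r/(7(1+r²))` (`q(r) = (7/10)(1 + r²)`, the ν = 1 SHAPE of HamEtAl2013 §4 with the
SYNTHETIC value `q₀ = 7/10`, said so), the FORCE-BALANCE pressure `p = 2/(49(1+r²)²) − 1/98 + 1/4900`
(`isRadialPressureBalanceK` PROVED there: an EXACT ideal-MHD equilibrium, `β₀ = 151/2450`), plasma radius `a = 1`, the
DECLARED aspect-ratio choice `R₀ = 5a` so that `n = 1` is `k = −n/R₀ = −1/5` (`RwmFRS1.kk`) — CONTINUED (this row) by a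
VACUUM region `a < r < b` and a thin resistive wall at `r = b` [cite: Freidberg2014, §11.5.6].  CLASS C = the external helical
mode `(m, n) = (2, 1)`: `q_a = 7/5 < 2`, so `F = k·B = (13 − 7r²)/(35(1+r²))` has NO zero in the plasma (`q = 2` only at
`r² = 13/7 > a²`, in the vacuum): Newcomb's minimising equation `(fξ′)′ = gξ` [cite: Freidberg2014, §11.5.1 eq. (11.97),
§11.5.3 eq. (11.110)] is regular on `(0, a]` apart from the axis.  HONESTY: the SAME model's internal `(1,1)` kink
(resonant at `r² = 3/7`) is CERTIFIED UNSTABLE (row #95, `KinkEqQ07.kink_sigma_unstable`); the present row is about the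
external `(2,1)` mode only — juxtaposed, never merged, never «MHD stable»; nothing about a device.

THIS FILE (no numerics): `PK` (the profile by name); the closed forms of `F`, `F†`, `k₀²`, `f`, `f′`, `g` for
`(m,k) = (2, −1/5)` (`g = r·G_K(r²)/(1225(1+r²)³(r²+100)²)` WITH the pressure term `2μ₀k²p′/k₀²`,
`G_K(s) = (13−7s)(1+s)G_z(s) − 400s(s+100)`, `G_z(s) = (13−7s)(s+75)(s+100) − 50s(27+7s)`, `G_K > 0` on `[0,1]`), the signs
`f > 0`, `g > 0` on `(0, a]`, `F ≠ 0`; the marginal equation as `P₂ξ″ + P₁ξ′ + P₀ξ = 0` with integer polynomial coefficients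
(`Kq07.rwmEq2p : LinearODE.Equation`) and the BRIDGE `newcomb_of_isSolOn` to lit-4's form `HasDerivAt (f·ξ′) (g ξ)`; the
regularity hypotheses; and the BOUNDARY FORM of the reference energies at `a = 1` [cite: Freidberg2014, §11.5.6 eq.
(11.148)–(11.149)]: `F_a = 3/35`, `F†_a = −17/35`, `k₀²(a) = 101/25`, hence `δŴ(Λ)/ξ_a² = (9L − 51)/4949 + 9Λ/2450` with
`L = aξ′(a)/ξ(a)` (`Kq07.boundaryForm`, `boundaryForm_eq`), `Λ_crit(L) = 2450(17 − 3L)/14847`.  Companions: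
`RwmFRS1Kq07Axis*`, `RwmFRS1Kq07Chain`, `RwmFRS1Kq07Solution`, `RwmFRS1Kq07Energy`. [instance data]
-/

noncomputable section

open Set Polynomial Literature.MathematicalPhysics.MHD Literature.Computation.Certificates
  Literature.Computation.Certificates.LinearODE

namespace Summit.Ventures.FusionMHD.Models

namespace RwmFRS1

namespace Kq07

/-! ### The model: the force-balanced `q₀ = 7/10` screw pinch (by name) -/

/-- MODEL M_RWM,K's plasma equilibrium = row #95's exact force-balanced `KinkEqQ07.hlK` seen as a `ScrewPinch.Profile`
(`μ₀ = 1`, `B_θ = 2r/(7(1+r²))`, `B_z ≡ 1`, `p = 2/(49(1+r²)²) − 1/98 + 1/4900`). [instance data] -/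
def PK : ScrewPinch.Profile := KinkEqQ07.hlK.toProfile

/-- `μ₀ = 1`. [instance data] -/
@[simp] theorem PK_μ₀ : PK.μ₀ = 1 := rfl

/-- `B_z ≡ 1`. [instance data] -/
@[simp] theorem PK_Bz (r : ℝ) : PK.Bz r = 1 := rfl

/-- `B_θ(r) = 2r/(7(1+r²))`. [instance data] -/
theorem PK_Bθ (r : ℝ) : PK.Bθ r = 2 * r / (7 * (1 + r ^ 2)) := by
  show r * KinkEqQ07.uK r = _
  rw [KinkEqQ07.uK]
  ring

/-- `p(r) = 2/(49(1+r²)²) − 1/98 + 1/4900` (force balance). [instance data] -/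
theorem PK_p (r : ℝ) : PK.p r = 2 / (49 * (1 + r ^ 2) ^ 2) - 1 / 98 + 1 / 4900 := rfl

/-- `p′(r) = −8r/(49(1+r²)³)`. [instance data] -/
theorem hasDerivAt_p (r : ℝ) : HasDerivAt PK.p (-8 * r / (49 * (1 + r ^ 2) ^ 3)) r := by
  have e : PK.p = fun s : ℝ => 2 / (49 * (1 + s ^ 2) ^ 2) - 1 / 98 + 1 / 4900 := funext PK_p
  rw [e]
  have h1 : (0 : ℝ) < 1 + r ^ 2 := by positivity
  have hc : HasDerivAt (fun s : ℝ => 1 + s ^ 2) (2 * r) r := by simpa using (hasDerivAt_pow 2 r).const_add 1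
  have hd : HasDerivAt (fun s : ℝ => 49 * (1 + s ^ 2) ^ 2) (49 * (2 * (1 + r ^ 2) * (2 * r))) r := by
    have := (hc.pow 2).const_mul 49
    exact this.congr_deriv (by push_cast; ring)
  have hq : HasDerivAt (fun s : ℝ => 2 / (49 * (1 + s ^ 2) ^ 2)) (-8 * r / (49 * (1 + r ^ 2) ^ 3)) r := by
    have := (hasDerivAt_const r (2 : ℝ)).div hd (by positivity)
    refine this.congr_deriv ?_
    field_simp
    ring
  exact (hq.sub_const (1 / 98 : ℝ)).add_const (1 / 4900 : ℝ)

/-- `deriv p = p′`. [instance data] -/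
theorem deriv_p (r : ℝ) : deriv PK.p r = -8 * r / (49 * (1 + r ^ 2) ^ 3) := (hasDerivAt_p r).deriv

/-- The pressure is `C¹`. [instance data] -/
theorem contDiff_p : ContDiff ℝ 1 PK.p := KinkEqQ07.contDiff_pK

/-- MODEL M_RWM,K is an EXACT equilibrium: radial pressure balance on `(0, 1)` (row #95's model file, by name).
[instance data] -/
theorem isRadialPressureBalance : PK.IsRadialPressureBalance 1 := KinkEqQ07.isRadialPressureBalanceK

/-- `B_θ` is `C¹` on `ℝ`. [instance data] -/
theorem contDiff_Bθ : ContDiff ℝ 1 PK.Bθ := by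
  rw [show PK.Bθ = fun r : ℝ => 2 * r / (7 * (1 + r ^ 2)) from funext PK_Bθ]
  exact ContDiff.div (by fun_prop) (by fun_prop) fun r => by positivity

/-- The regularity hypotheses of Newcomb's external-mode test for this profile on `(−b, b)`, any `b`. [instance data] -/
theorem profile_regular (b : ℝ) :
    ContDiffOn ℝ 1 PK.Bθ (Ioo (-b) b) ∧ ContDiffOn ℝ 1 PK.Bz (Ioo (-b) b) ∧ ContDiffOn ℝ 1 PK.p (Ioo (-b) b) ∧
      PK.Bθ 0 = 0 := by
  refine ⟨contDiff_Bθ.contDiffOn, ?_, contDiff_p.contDiffOn, by rw [PK_Bθ]; simp⟩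
  rw [show PK.Bz = fun _ => (1 : ℝ) from funext PK_Bz]; exact contDiffOn_const

/-! ### Closed forms of `F`, `F†`, `k₀²`, `f`, `g` for `(m, k) = (2, −1/5)` -/

/-- `F = kB_z + mB_θ/r = (13 − 7r²)/(35(1+r²))` (`r ≠ 0`). [cite: Freidberg2014, §11.5.1 eq. (11.90)] -/
theorem kDotB_eq {r : ℝ} (hr : r ≠ 0) : PK.kDotB 2 kk r = (13 - 7 * r ^ 2) / (35 * (1 + r ^ 2)) := by
  have h1 : (0 : ℝ) < 1 + r ^ 2 := by positivity
  rw [ScrewPinch.Profile.kDotB, PK_Bθ, PK_Bz, kk]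
  field_simp
  ring

/-- `F† = kB_z − mB_θ/r = −(27 + 7r²)/(35(1+r²))` (`r ≠ 0`). [cite: Freidberg2014, §11.5.1 eq. (11.89)] -/
theorem kDotBDagger_eq {r : ℝ} (hr : r ≠ 0) : PK.kDotBDagger 2 kk r = -(27 + 7 * r ^ 2) / (35 * (1 + r ^ 2)) := by
  have h1 : (0 : ℝ) < 1 + r ^ 2 := by positivity
  rw [ScrewPinch.Profile.kDotBDagger, PK_Bθ, PK_Bz, kk]
  field_simp
  ring

/-- `k₀² = k² + m²/r² = (r² + 100)/(25r²)` for `m = 2` (`r ≠ 0`). [cite: Freidberg2014, §11.5.1 eq. (11.85)] -/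
theorem k0Sq_eq {r : ℝ} (hr : r ≠ 0) : ScrewPinch.Profile.k0Sq 2 kk r = (r ^ 2 + 100) / (25 * r ^ 2) := by
  rw [ScrewPinch.Profile.k0Sq, kk]
  field_simp
  ring

/-- Newcomb's `f = rF²/k₀² = r³(13−7r²)²/(49(1+r²)²(r²+100))` (`r ≠ 0`). [cite: Freidberg2014, §11.5.1 eq. (11.90)] -/
theorem newcombF_eq {r : ℝ} (hr : r ≠ 0) :
    PK.newcombF 2 kk r = r ^ 3 * (13 - 7 * r ^ 2) ^ 2 / (49 * (1 + r ^ 2) ^ 2 * (r ^ 2 + 100)) := by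
  have h1 : (0 : ℝ) < 1 + r ^ 2 := by positivity
  have h2 : (0 : ℝ) < r ^ 2 + 100 := by positivity
  rw [ScrewPinch.Profile.newcombF, kDotB_eq hr, k0Sq_eq hr]
  field_simp
  ring

/-- The zero-β cubic `G_z(s) = (13−7s)(s+75)(s+100) − 50s(27+7s) = 97500 − 51575s − 1562s² − 7s³` (the current-driven part
of the numerator of `g`). [instance data] -/
def Gz (s : ℝ) : ℝ := 97500 - 51575 * s - 1562 * s ^ 2 - 7 * s ^ 3

/-- `G_z(s) = (13−7s)(s+75)(s+100) − 50s(27+7s)`. [instance data] -/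
theorem Gz_eq (s : ℝ) : Gz s = (13 - 7 * s) * (s + 75) * (s + 100) - 50 * s * (27 + 7 * s) := by
  unfold Gz; ring

/-- `G_z ≥ 44356` on `[0, 1]` (decreasing; value at `s = 1`). [instance data] -/
theorem Gz_ge {s : ℝ} (h0 : 0 ≤ s) (h1 : s ≤ 1) : 44356 ≤ Gz s := by
  unfold Gz
  have h2 : s ^ 2 ≤ 1 := by nlinarith
  have h3 : s ^ 3 ≤ 1 := by nlinarith
  nlinarith

/-- The quintic `G_K(s) = (13−7s)(1+s)G_z(s) − 400s(s+100) = 1267500 − 125475s − 1012656s² + 351562s³ + 10892s⁴ + 49s⁵`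
(numerator of `g` WITH the force-balance pressure term). [instance data] -/
def Gpoly (s : ℝ) : ℝ := 1267500 - 125475 * s - 1012656 * s ^ 2 + 351562 * s ^ 3 + 10892 * s ^ 4 + 49 * s ^ 5

/-- `G_K(s) = (13−7s)(1+s)·G_z(s) − 400s(s+100)`. [instance data] -/
theorem Gpoly_eq (s : ℝ) : Kq07.Gpoly s = (13 - 7 * s) * (1 + s) * Gz s - 400 * s * (s + 100) := by
  unfold Kq07.Gpoly Gz; ring

/-- `G_K > 0` on `[0, 1]` (`(13−7s)(1+s)G_z(s) ≥ 12·44356 > 40400 ≥ 400s(s+100)` there). [instance data] -/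
theorem Gpoly_pos {s : ℝ} (h0 : 0 ≤ s) (h1 : s ≤ 1) : 0 < Kq07.Gpoly s := by
  rw [Gpoly_eq]
  have hG := Gz_ge h0 h1
  have h12 : 12 ≤ (13 - 7 * s) * (1 + s) := by nlinarith
  have hprod : 12 * 44356 ≤ (13 - 7 * s) * (1 + s) * Gz s := by
    have := mul_le_mul h12 hG (by norm_num) (by nlinarith)
    linarith
  nlinarith

/-- Newcomb's `g` (11.90) WITH the force-balance pressure: `g = r·G_K(r²)/(1225(1+r²)³(r²+100)²)` (`r ≠ 0`).
[cite: Freidberg2014, §11.5.1 eq. (11.90)] -/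
theorem newcombG_eq {r : ℝ} (hr : r ≠ 0) :
    PK.newcombG 2 kk r = r * Kq07.Gpoly (r ^ 2) / (1225 * (1 + r ^ 2) ^ 3 * (r ^ 2 + 100) ^ 2) := by
  have h1 : (0 : ℝ) < 1 + r ^ 2 := by positivity
  have h2 : (0 : ℝ) < r ^ 2 + 100 := by positivity
  rw [ScrewPinch.Profile.newcombG, deriv_p, kDotB_eq hr, kDotBDagger_eq hr, k0Sq_eq hr, Kq07.Gpoly, kk, PK_μ₀]
  field_simp
  ring

/-- `F ≠ 0` on `0 < r`, `r² < 13/7` (no resonant surface of the `(2,1)` mode in the plasma: `q < 2`). [instance data] -/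
theorem kDotB_ne_zero {r : ℝ} (hr : 0 < r) (h : r ^ 2 < 13 / 7) : PK.kDotB 2 kk r ≠ 0 := by
  rw [kDotB_eq hr.ne']
  have h1 : (0 : ℝ) < 1 + r ^ 2 := by positivity
  exact div_ne_zero (by nlinarith) (by positivity)

/-- `F > 0` there. [instance data] -/
theorem kDotB_pos {r : ℝ} (hr : 0 < r) (h : r ^ 2 < 13 / 7) : 0 < PK.kDotB 2 kk r := by
  rw [kDotB_eq hr.ne']
  have h1 : (0 : ℝ) < 1 + r ^ 2 := by positivity
  exact div_pos (by nlinarith) (by positivity)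

/-- `f > 0` on `0 < r`, `r² < 13/7`. [instance data] -/
theorem newcombF_pos {r : ℝ} (hr : 0 < r) (h : r ^ 2 < 13 / 7) : 0 < PK.newcombF 2 kk r := by
  rw [newcombF_eq hr.ne']
  have h3 : (0 : ℝ) < (13 - 7 * r ^ 2) ^ 2 := by nlinarith
  positivity

/-- `g > 0` on the plasma `0 < r ≤ 1` (= a): the destabilising pressure term is dominated. [instance data] -/
theorem newcombG_pos {r : ℝ} (hr : 0 < r) (h : r ≤ 1) : 0 < PK.newcombG 2 kk r := by
  rw [newcombG_eq hr.ne']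
  have hr2 : r ^ 2 ≤ 1 := by nlinarith
  have hG := Gpoly_pos (sq_nonneg r) hr2
  positivity

/-! ### The marginal equation in certificate form and the bridge to Newcomb's `(fξ′)′ = gξ` -/

/-- Newcomb's marginal equation of MODEL M_RWM,K, mode `(2,1)`, cleared of denominators: `P₂ξ″ + P₁ξ′ + P₀ξ = 0` with
`P₂ = 25r²(13−7r²)²(1+r²)(r²+100)`, `P₁ = 25r(13−7r²)(3900 − 6187r² − 2174r⁴ − 7r⁶)`, `P₀ = −G_K(r²)` (coefficient lists,
low degree first; exact integers). [instance data] -/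
def rwmEq2p : Equation :=
  ⟨[0, 0, 422500, 0, -28275, 0, -332825, 0, 119175, 0, 1225], [0, 1267500, 0, -2693275, 0, 376175, 0, 378175, 0, 1225],
    [-1267500, 0, 125475, 0, 1012656, 0, -351562, 0, -10892, 0, -49]⟩

/-- `P₂(r) = 25r²(13−7r²)²(1+r²)(r²+100)`. [instance data] -/
theorem eval_P2 (r : ℝ) :
    (toPolyR Kq07.rwmEq2p.P2).eval r = 25 * r ^ 2 * (13 - 7 * r ^ 2) ^ 2 * (1 + r ^ 2) * (r ^ 2 + 100) := by
  simp [Kq07.rwmEq2p, toPolyR, Finset.sum_range_succ]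
  ring

/-- `P₁(r) = 25r(13−7r²)(3900 − 6187r² − 2174r⁴ − 7r⁶)`. [instance data] -/
theorem eval_P1 (r : ℝ) :
    (toPolyR Kq07.rwmEq2p.P1).eval r = 25 * r * (13 - 7 * r ^ 2) * (3900 - 6187 * r ^ 2 - 2174 * r ^ 4 - 7 * r ^ 6) := by
  simp [Kq07.rwmEq2p, toPolyR, Finset.sum_range_succ]
  ring

/-- `P₀(r) = −G_K(r²)`. [instance data] -/
theorem eval_P0 (r : ℝ) : (toPolyR Kq07.rwmEq2p.P0).eval r = -Kq07.Gpoly (r ^ 2) := by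
  rw [Kq07.Gpoly]
  simp [Kq07.rwmEq2p, toPolyR, Finset.sum_range_succ]
  ring

/-- `P₂ ≠ 0` on `0 < r`, `r² < 13/7`. [instance data] -/
theorem eval_P2_ne_zero {r : ℝ} (hr : 0 < r) (h : r ^ 2 < 13 / 7) : (toPolyR Kq07.rwmEq2p.P2).eval r ≠ 0 := by
  rw [eval_P2]
  have h8 : (0 : ℝ) < (13 - 7 * r ^ 2) ^ 2 := by nlinarith
  positivity

/-- The solved-form coefficient `𝔭 = −P₁/P₂`. [instance data] -/
theorem pH_eq {r : ℝ} (hr : 0 < r) (h : r ^ 2 < 13 / 7) :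
    Kq07.rwmEq2p.pH r = -(3900 - 6187 * r ^ 2 - 2174 * r ^ 4 - 7 * r ^ 6) /
      (r * (13 - 7 * r ^ 2) * (1 + r ^ 2) * (r ^ 2 + 100)) := by
  have h8 : (13 - 7 * r ^ 2 : ℝ) ≠ 0 := by nlinarith
  have h1 : (0 : ℝ) < 1 + r ^ 2 := by positivity
  have h2 : (0 : ℝ) < r ^ 2 + 100 := by positivity
  have hr0 := hr.ne'
  rw [Equation.pH, eval_P1, eval_P2]
  field_simp

/-- The solved-form coefficient `𝔮 = −P₀/P₂ = g/f`. [instance data] -/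
theorem qH_eq (r : ℝ) :
    Kq07.rwmEq2p.qH r = Kq07.Gpoly (r ^ 2) / (25 * r ^ 2 * (13 - 7 * r ^ 2) ^ 2 * (1 + r ^ 2) * (r ^ 2 + 100)) := by
  rw [Equation.qH, eval_P0, eval_P2]
  ring

/-- The derivative of `f`: `f′ = r²(13−7r²)(3900 − 6187r² − 2174r⁴ − 7r⁶)/(49(1+r²)³(r²+100)²)` on `0 < r`
(so `P₁/P₂ = f′/f`). [instance data] -/
theorem hasDerivAt_newcombF {r : ℝ} (hr : 0 < r) :
    HasDerivAt (PK.newcombF 2 kk)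
      (r ^ 2 * (13 - 7 * r ^ 2) * (3900 - 6187 * r ^ 2 - 2174 * r ^ 4 - 7 * r ^ 6) /
        (49 * (1 + r ^ 2) ^ 3 * (r ^ 2 + 100) ^ 2)) r := by
  have h1 : (0 : ℝ) < 1 + r ^ 2 := by positivity
  have h2 : (0 : ℝ) < r ^ 2 + 100 := by positivity
  have hev : (fun s => s ^ 3 * (13 - 7 * s ^ 2) ^ 2 / (49 * (1 + s ^ 2) ^ 2 * (s ^ 2 + 100))) =ᶠ[nhds r]
      PK.newcombF 2 kk := by
    filter_upwards [isOpen_Ioi.mem_nhds hr] with s hs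
    rw [newcombF_eq (ne_of_gt hs)]
  have hd : HasDerivAt (fun s : ℝ => s ^ 3 * (13 - 7 * s ^ 2) ^ 2 / (49 * (1 + s ^ 2) ^ 2 * (s ^ 2 + 100)))
      (((3 * r ^ 2 * (13 - 7 * r ^ 2) ^ 2 + r ^ 3 * (2 * (13 - 7 * r ^ 2) * (-(7 * (2 * r))))) *
          (49 * (1 + r ^ 2) ^ 2 * (r ^ 2 + 100)) -
        r ^ 3 * (13 - 7 * r ^ 2) ^ 2 * (49 * (2 * (1 + r ^ 2) * (2 * r)) * (r ^ 2 + 100) + 49 * (1 + r ^ 2) ^ 2 * (2 * r))) /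
        (49 * (1 + r ^ 2) ^ 2 * (r ^ 2 + 100)) ^ 2) r := by
    have hnum : HasDerivAt (fun s : ℝ => s ^ 3 * (13 - 7 * s ^ 2) ^ 2)
        (3 * r ^ 2 * (13 - 7 * r ^ 2) ^ 2 + r ^ 3 * (2 * (13 - 7 * r ^ 2) * (-(7 * (2 * r))))) r := by
      have ha := hasDerivAt_pow 3 r
      have hb : HasDerivAt (fun s : ℝ => 13 - 7 * s ^ 2) (-(7 * (2 * r))) r := by
        simpa using ((hasDerivAt_pow 2 r).const_mul 7).const_sub 13
      have hb2 := hb.pow 2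
      exact (ha.mul hb2).congr_deriv (by simp only [Pi.pow_apply]; push_cast; ring)
    have hden : HasDerivAt (fun s : ℝ => 49 * (1 + s ^ 2) ^ 2 * (s ^ 2 + 100))
        (49 * (2 * (1 + r ^ 2) * (2 * r)) * (r ^ 2 + 100) + 49 * (1 + r ^ 2) ^ 2 * (2 * r)) r := by
      have hc : HasDerivAt (fun s : ℝ => 1 + s ^ 2) (2 * r) r := by
        simpa using (hasDerivAt_pow 2 r).const_add 1
      have hc2 := (hc.pow 2).const_mul 49
      have he : HasDerivAt (fun s : ℝ => s ^ 2 + 100) (2 * r) r := by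
        simpa using (hasDerivAt_pow 2 r).add_const 100
      exact (hc2.mul he).congr_deriv (by simp only [Pi.pow_apply]; push_cast; ring)
    exact hnum.div hden (by positivity)
  refine (hd.congr_of_eventuallyEq hev.symm).congr_deriv ?_
  field_simp
  ring

/-- **BRIDGE.** A pair `(ξ, ξ′)` solving `Kq07.rwmEq2p` in the certificate sense on an OPEN set `s ⊆ {0 < r, r² < 13/7}`
(`ξ′ = dξ/dr`, `ξ″ = 𝔭ξ′ + 𝔮ξ`) satisfies Newcomb's marginal equation in lit-4's form there: `d/dr (f · deriv ξ) = g ξ`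
for MODEL M_RWM,K. [cite: Freidberg2014, §11.5.3 eq. (11.110)] -/
theorem newcomb_of_isSolOn {ξ ξ' : ℝ → ℝ} {s : Set ℝ} (hs : IsOpen s) (hsub : ∀ r ∈ s, 0 < r ∧ r ^ 2 < 13 / 7)
    (hsol : Kq07.rwmEq2p.IsSolOn ξ ξ' s) {r : ℝ} (hr : r ∈ s) :
    HasDerivAt (fun x => PK.newcombF 2 kk x * deriv ξ x) (PK.newcombG 2 kk r * ξ r) r := by
  obtain ⟨hr0, hr8⟩ := hsub r hr
  obtain ⟨h1, h2⟩ := hsol r hr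
  have hev : ξ' =ᶠ[nhds r] deriv ξ := by
    filter_upwards [hs.mem_nhds hr] with x hx
    exact ((hsol x hx).1.deriv).symm
  have h2' : HasDerivAt (deriv ξ) (Kq07.rwmEq2p.pH r * ξ' r + Kq07.rwmEq2p.qH r * ξ r) r :=
    h2.congr_of_eventuallyEq hev.symm
  have hf := hasDerivAt_newcombF hr0
  have hprod := hf.mul h2'
  refine hprod.congr_deriv ?_
  rw [h1.deriv, newcombF_eq hr0.ne', newcombG_eq hr0.ne', pH_eq hr0 hr8, qH_eq]
  have h8 : (13 - 7 * r ^ 2 : ℝ) ≠ 0 := by nlinarith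
  have h8b : (13 : ℝ) - r ^ 2 * 7 ≠ 0 := by nlinarith
  have h8sq : ((13 : ℝ) - 7 * r ^ 2) ^ 2 ≠ 0 := pow_ne_zero 2 h8
  have h1' : (0 : ℝ) < 1 + r ^ 2 := by positivity
  have h2'' : (0 : ℝ) < r ^ 2 + 100 := by positivity
  have hr0' := hr0.ne'
  field_simp
  ring

/-! ### The boundary form of the reference energies at `a = 1` (Freidberg (11.148)–(11.149)), `m = 2` -/

/-- Edge values: `F_a = 3/35`, `F†_a = −17/35`, `k₀²(a) = 101/25`, `f(a) = 9/4949`. [instance data] -/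
theorem edge_values : PK.kDotB 2 kk 1 = 3 / 35 ∧ PK.kDotBDagger 2 kk 1 = -17 / 35 ∧
    ScrewPinch.Profile.k0Sq 2 kk 1 = 101 / 25 ∧ PK.newcombF 2 kk 1 = 9 / 4949 := by
  refine ⟨?_, ?_, ?_, ?_⟩
  · rw [kDotB_eq one_ne_zero]; norm_num
  · rw [kDotBDagger_eq one_ne_zero]; norm_num
  · rw [k0Sq_eq one_ne_zero]; norm_num
  · rw [newcombF_eq one_ne_zero]; norm_num

/-- THE BOUNDARY FORM of the reference energies per `ξ(a)²`, as a function of the logarithmic derivative `L = aξ′(a)/ξ(a)`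
of the marginal solution and the wall factor `Λ`: `δŴ(L, Λ) := (F²/k₀²) L + FF†/k₀² + a²F²Λ/m` at `a = 1`, `m = 2`, for
MODEL M_RWM,K. [cite: Freidberg2014, §11.5.6 eq. (11.148)–(11.149)] -/
def boundaryForm (L Λ : ℝ) : ℝ :=
  PK.kDotB 2 kk 1 ^ 2 / ScrewPinch.Profile.k0Sq 2 kk 1 * L +
    PK.kDotB 2 kk 1 * PK.kDotBDagger 2 kk 1 / ScrewPinch.Profile.k0Sq 2 kk 1 +
    1 ^ 2 * PK.kDotB 2 kk 1 ^ 2 * Λ / 2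

/-- **`δŴ(L, Λ) = (9L − 51)/4949 + 9Λ/2450`** (exact). [instance data] -/
theorem boundaryForm_eq (L Λ : ℝ) : Kq07.boundaryForm L Λ = (9 * L - 51) / 4949 + 9 * Λ / 2450 := by
  obtain ⟨e1, e2, e3, -⟩ := edge_values
  rw [Kq07.boundaryForm, e1, e2, e3]
  ring

/-- `δŴ` is the quantity of lit-4's `newcombExternalModes_iff` (its right-hand side is `δŴ(aξ₁′(a)/ξ₁(a), Λ)·ξ₁(a)²`
at `a = 1`, `m = 2`) for MODEL M_RWM,K. [cite: Freidberg2014, §11.5.3 eq. (11.118)] -/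
theorem boundaryForm_mul (ξ₁ : ℝ → ℝ) (Λ : ℝ) :
    (PK.kDotB 2 kk 1 ^ 2 / ScrewPinch.Profile.k0Sq 2 kk 1 * (1 * deriv ξ₁ 1 / ξ₁ 1) +
        PK.kDotB 2 kk 1 * PK.kDotBDagger 2 kk 1 / ScrewPinch.Profile.k0Sq 2 kk 1 +
        1 ^ 2 * PK.kDotB 2 kk 1 ^ 2 * Λ / 2) * ξ₁ 1 ^ 2 =
      Kq07.boundaryForm (1 * deriv ξ₁ 1 / ξ₁ 1) Λ * ξ₁ 1 ^ 2 := by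
  rw [Kq07.boundaryForm]

/-- `δŴ` is strictly increasing in `Λ` (slope `F_a²/2 = 9/2450 > 0`): the wall can only help.
[cite: Freidberg2014, §11.5.6 eq. (11.150)] -/
theorem boundaryForm_strictMono (L : ℝ) : StrictMono (Kq07.boundaryForm L) := by
  intro x y hxy
  rw [boundaryForm_eq, boundaryForm_eq]
  linarith

/-- The critical wall factor at which `δŴ` changes sign: `Λ_crit(L) = 2450(17 − 3L)/14847`, i.e.
`δŴ(L, Λ) = 9(Λ − Λ_crit(L))/2450`. [instance data] -/
def lambdaCrit (L : ℝ) : ℝ := 2450 * (17 - 3 * L) / 14847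

/-- `δŴ(L, Λ) = 9(Λ − Λ_crit)/2450`. [instance data] -/
theorem boundaryForm_eq_sub (L Λ : ℝ) : Kq07.boundaryForm L Λ = 9 * (Λ - Kq07.lambdaCrit L) / 2450 := by
  rw [boundaryForm_eq, Kq07.lambdaCrit]
  ring

/-- `δŴ > 0 ⟺ Λ > Λ_crit`. [instance data] -/
theorem boundaryForm_pos_iff (L Λ : ℝ) : 0 < Kq07.boundaryForm L Λ ↔ Kq07.lambdaCrit L < Λ := by
  rw [boundaryForm_eq_sub]
  constructor
  · intro h; by_contra hle; rw [not_lt] at hle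
    have : 9 * (Λ - Kq07.lambdaCrit L) / 2450 ≤ 0 := div_nonpos_of_nonpos_of_nonneg (by linarith) (by norm_num)
    linarith
  · intro h; exact div_pos (by linarith) (by norm_num)

/-- `δŴ < 0 ⟺ Λ < Λ_crit`. [instance data] -/
theorem boundaryForm_neg_iff (L Λ : ℝ) : Kq07.boundaryForm L Λ < 0 ↔ Λ < Kq07.lambdaCrit L := by
  rw [boundaryForm_eq_sub]
  constructor
  · intro h; by_contra hle; rw [not_lt] at hle
    have : 0 ≤ 9 * (Λ - Kq07.lambdaCrit L) / 2450 := div_nonneg (by linarith) (by norm_num)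
    linarith
  · intro h; exact div_neg_of_neg_of_pos (by linarith) (by norm_num)

end Kq07

end RwmFRS1

end Summit.Ventures.FusionMHD.Models

end
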